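import Summits.KontsevichZagierPeriods.Zeta5Search.Certificates.LogEnclosuresRecord4
import Mathlib.Analysis.SpecialFunctions.Trigonometric.ArctanDeriv
import Mathlib.Analysis.Real.Pi.Bounds
import HarnessLib

/-!
# ζ(5) search — certificates: the record ray's line-profile constant `Ψ ≤ −95.359` (cell `pub-zeta5`, cert-2 g2)

HONEST FRAMING: systematic search; no irrationality claim unless certified.

OUR work (Summit side; certifier 2, generation 2). The two-heights Eisenstein bound for the ζ(3)-coefficient `W(b)` on the
record ray (`Certificates/RecordRayCoeffBound.lean`, `…CentreAsymp.lean`) has linear-in-`n` rate `12π + Ψ/2` with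
`Ψ = 2Γ₃(41/2) − 2Σ_{j<7} Γ₃(τ_j)`, `Γ₃(τ) = τ·log(τ²+9) − 2τ + 6·arctan(τ/3)`, `τ_j = (7+2j)/2`. This file certifies

  `Γ₃(41/2) ≤ 91824729/1000000`, `Γ₃(τ_j) ≥ L_j` (seven rationals), hence `Ψ ≤ −95359/1000` (`psi_explicit_le`;
  true value `−95.35950`),

from the log enclosures of `Certificates/LogEnclosuresRecord4.lean`, Mathlib's `π` to six places, the reductions
`arctan(41/6) = π/2 − arctan(6/41)`, `arctan(τ/3) = π/4 + arctan((τ−3)/(τ+3))`, and the elementary lower bound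
`y − y³/3 + y⁵/5 − y⁷/7 + y⁹/9 − y¹¹/11 ≤ arctan y` (`y ≥ 0`, by monotonicity: the derivative of the difference is
`y¹²/(1+y²) ≥ 0`). The statements are in the explicit (`norm_num`-normal) form
`τ·log(N/4) − 2τ + 6·arctan(τ/3)`, `N = 4(τ²+9)`, so that `unfold`ing `Γ₃` and `norm_num` reach them.
Generated by cert-2 g2 `code/gen_psibound.py`; the kernel checks every line.
-/

noncomputable section

open Finset Real

namespace Summit.KontsevichZagierPeriods.Zeta5Search.LogEnclosures

/-- `y − y³/3 + y⁵/5 − y⁷/7 + y⁹/9 − y¹¹/11 ≤ arctan y` for `y ≥ 0` (the degree-11 Taylor polynomial is a lower bound: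
the difference has derivative `y¹²/(1+y²) ≥ 0` and vanishes at `0`). -/
theorem taylor11_le_arctan {y : ℝ} (hy : 0 ≤ y) :
    y - y ^ 3 / 3 + y ^ 5 / 5 - y ^ 7 / 7 + y ^ 9 / 9 - y ^ 11 / 11 ≤ Real.arctan y := by
  have hderiv : ∀ t, HasDerivAt
      (fun t : ℝ => Real.arctan t - (t - t ^ 3 / 3 + t ^ 5 / 5 - t ^ 7 / 7 + t ^ 9 / 9 - t ^ 11 / 11))
      (t ^ 12 / (1 + t ^ 2)) t := by
    intro t
    have h1 := Real.hasDerivAt_arctan t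
    have h2 : HasDerivAt (fun t : ℝ => t - t ^ 3 / 3 + t ^ 5 / 5 - t ^ 7 / 7 + t ^ 9 / 9 - t ^ 11 / 11)
        (1 - t ^ 2 + t ^ 4 - t ^ 6 + t ^ 8 - t ^ 10) t := by
      have := ((((((hasDerivAt_id' t).fun_sub ((hasDerivAt_pow 3 t).div_const 3)).fun_add
        ((hasDerivAt_pow 5 t).div_const 5)).fun_sub ((hasDerivAt_pow 7 t).div_const 7)).fun_add
        ((hasDerivAt_pow 9 t).div_const 9)).fun_sub ((hasDerivAt_pow 11 t).div_const 11))
      push_cast at this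
      refine this.congr_deriv ?_
      ring
    have hq : (1 : ℝ) + t ^ 2 ≠ 0 := by positivity
    have key : (1 - t ^ 2 + t ^ 4 - t ^ 6 + t ^ 8 - t ^ 10 : ℝ) = (1 - t ^ 12) / (1 + t ^ 2) := by
      rw [eq_div_iff hq]; ring
    refine (h1.fun_sub h2).congr_deriv ?_
    rw [key]
    ring
  have hmono : Monotone
      (fun t : ℝ => Real.arctan t - (t - t ^ 3 / 3 + t ^ 5 / 5 - t ^ 7 / 7 + t ^ 9 / 9 - t ^ 11 / 11)) := by
    apply monotone_of_deriv_nonneg (fun t => (hderiv t).differentiableAt)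
    intro t
    rw [(hderiv t).deriv]
    positivity
  have := hmono hy
  simp only [Real.arctan_zero] at this
  norm_num at this
  linarith

/-- `arctan(τ/3) = π/4 + arctan((τ−3)/(τ+3))` for `τ > 0` (addition formula with `arctan 1 = π/4`). -/
theorem arctan_div_three {τ : ℝ} (hτ : 0 < τ) :
    Real.arctan (τ / 3) = π / 4 + Real.arctan ((τ - 3) / (τ + 3)) := by
  have h : (1 : ℝ) * ((τ - 3) / (τ + 3)) < 1 := by
    rw [one_mul, div_lt_one (by linarith)]; linarith
  rw [← Real.arctan_one, Real.arctan_add h]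
  congr 1
  have h3 : τ + 3 ≠ 0 := by linarith
  field_simp
  ring


/-- `Γ₃(41/2) = 41/2·log(1717/4) − 41 + 6·arctan(41/6) ≤ 91824729/1000000` (true value `91.8247286`). -/
theorem gam3_record_upper :
    41 / 2 * Real.log (1717 / 4) - 41 + 6 * Real.arctan (41 / 6) ≤ (91824729 / 1000000 : ℝ) := by
  have hlog : Real.log ((1717 : ℝ) / 4) = Real.log 1717 - Real.log 4 := Real.log_div (by norm_num) (by norm_num)
  have hat : Real.arctan ((41 : ℝ) / 6) = π / 2 - Real.arctan (6 / 41) := by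
    rw [show ((41 : ℝ) / 6) = (6 / 41)⁻¹ by norm_num]; exact Real.arctan_inv_of_pos (by norm_num)
  have hL := taylor11_le_arctan (y := (6 : ℝ) / 41) (by norm_num)
  obtain ⟨a1, a2⟩ := log_1717_bounds
  obtain ⟨b1, b2⟩ := log_4_bounds
  have hpi := Real.pi_lt_d6
  rw [hlog, hat]
  norm_num at hL hpi ⊢
  linarith

/-- `Γ₃(7/2) = 7/2·log(85/4) − 7 + 6·arctan(7/6) ≥ 2217567/250000` (true value `8.8702695`). -/
theorem gam3_tau0_lower :
    (2217567 / 250000 : ℝ) ≤ 7 / 2 * Real.log (85 / 4) - 7 + 6 * Real.arctan (7 / 6) := by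
  have hlog : Real.log ((85 : ℝ) / 4) = Real.log 85 - Real.log 4 := Real.log_div (by norm_num) (by norm_num)
  have hat : Real.arctan ((7 / 6 : ℝ)) = π / 4 + Real.arctan (1 / 13) := by
    rw [show ((7 / 6 : ℝ)) = (7 / 2) / 3 by norm_num, arctan_div_three (by norm_num)]
    norm_num
  have hL := taylor11_le_arctan (y := (1 : ℝ) / 13) (by norm_num)
  obtain ⟨a1, a2⟩ := log_85_bounds
  obtain ⟨b1, b2⟩ := log_4_bounds
  have hpi := Real.pi_gt_d6
  rw [hlog, hat]
  norm_num at hL hpi ⊢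
  linarith

/-- `Γ₃(9/2) = 9/2·log(117/4) − 9 + 6·arctan(3/2) ≥ 12088219/1000000` (true value `12.0882204`). -/
theorem gam3_tau1_lower :
    (12088219 / 1000000 : ℝ) ≤ 9 / 2 * Real.log (117 / 4) - 9 + 6 * Real.arctan (3 / 2) := by
  have hlog : Real.log ((117 : ℝ) / 4) = Real.log 117 - Real.log 4 := Real.log_div (by norm_num) (by norm_num)
  have hat : Real.arctan ((3 / 2 : ℝ)) = π / 4 + Real.arctan (1 / 5) := by
    rw [show ((3 / 2 : ℝ)) = (9 / 2) / 3 by norm_num, arctan_div_three (by norm_num)]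
    norm_num
  have hL := taylor11_le_arctan (y := (1 : ℝ) / 5) (by norm_num)
  obtain ⟨a1, a2⟩ := log_117_bounds
  obtain ⟨b1, b2⟩ := log_4_bounds
  have hpi := Real.pi_gt_d6
  rw [hlog, hat]
  norm_num at hL hpi ⊢
  linarith

/-- `Γ₃(11/2) = 11/2·log(157/4) − 11 + 6·arctan(11/6) ≥ 15613429/1000000` (true value `15.6134306`). -/
theorem gam3_tau2_lower :
    (15613429 / 1000000 : ℝ) ≤ 11 / 2 * Real.log (157 / 4) - 11 + 6 * Real.arctan (11 / 6) := by
  have hlog : Real.log ((157 : ℝ) / 4) = Real.log 157 - Real.log 4 := Real.log_div (by norm_num) (by norm_num)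
  have hat : Real.arctan ((11 / 6 : ℝ)) = π / 4 + Real.arctan (5 / 17) := by
    rw [show ((11 / 6 : ℝ)) = (11 / 2) / 3 by norm_num, arctan_div_three (by norm_num)]
    norm_num
  have hL := taylor11_le_arctan (y := (5 : ℝ) / 17) (by norm_num)
  obtain ⟨a1, a2⟩ := log_157_bounds
  obtain ⟨b1, b2⟩ := log_4_bounds
  have hpi := Real.pi_gt_d6
  rw [hlog, hat]
  norm_num at hL hpi ⊢
  linarith

/-- `Γ₃(13/2) = 13/2·log(205/4) − 13 + 6·arctan(13/6) ≥ 970949/50000` (true value `19.4189828`). -/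
theorem gam3_tau3_lower :
    (970949 / 50000 : ℝ) ≤ 13 / 2 * Real.log (205 / 4) - 13 + 6 * Real.arctan (13 / 6) := by
  have hlog : Real.log ((205 : ℝ) / 4) = Real.log 205 - Real.log 4 := Real.log_div (by norm_num) (by norm_num)
  have hat : Real.arctan ((13 / 6 : ℝ)) = π / 4 + Real.arctan (7 / 19) := by
    rw [show ((13 / 6 : ℝ)) = (13 / 2) / 3 by norm_num, arctan_div_three (by norm_num)]
    norm_num
  have hL := taylor11_le_arctan (y := (7 : ℝ) / 19) (by norm_num)
  obtain ⟨a1, a2⟩ := log_205_bounds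
  obtain ⟨b1, b2⟩ := log_4_bounds
  have hpi := Real.pi_gt_d6
  rw [hlog, hat]
  norm_num at hL hpi ⊢
  linarith

/-- `Γ₃(15/2) = 15/2·log(261/4) − 15 + 6·arctan(5/2) ≥ 23478427/1000000` (true value `23.4784350`). -/
theorem gam3_tau4_lower :
    (23478427 / 1000000 : ℝ) ≤ 15 / 2 * Real.log (261 / 4) - 15 + 6 * Real.arctan (5 / 2) := by
  have hlog : Real.log ((261 : ℝ) / 4) = Real.log 261 - Real.log 4 := Real.log_div (by norm_num) (by norm_num)
  have hat : Real.arctan ((5 / 2 : ℝ)) = π / 4 + Real.arctan (3 / 7) := by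
    rw [show ((5 / 2 : ℝ)) = (15 / 2) / 3 by norm_num, arctan_div_three (by norm_num)]
    norm_num
  have hL := taylor11_le_arctan (y := (3 : ℝ) / 7) (by norm_num)
  obtain ⟨a1, a2⟩ := log_261_bounds
  obtain ⟨b1, b2⟩ := log_4_bounds
  have hpi := Real.pi_gt_d6
  rw [hlog, hat]
  norm_num at hL hpi ⊢
  linarith

/-- `Γ₃(17/2) = 17/2·log(325/4) − 17 + 6·arctan(17/6) ≥ 13884003/500000` (true value `27.7680343`). -/
theorem gam3_tau5_lower :
    (13884003 / 500000 : ℝ) ≤ 17 / 2 * Real.log (325 / 4) - 17 + 6 * Real.arctan (17 / 6) := by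
  have hlog : Real.log ((325 : ℝ) / 4) = Real.log 325 - Real.log 4 := Real.log_div (by norm_num) (by norm_num)
  have hat : Real.arctan ((17 / 6 : ℝ)) = π / 4 + Real.arctan (11 / 23) := by
    rw [show ((17 / 6 : ℝ)) = (17 / 2) / 3 by norm_num, arctan_div_three (by norm_num)]
    norm_num
  have hL := taylor11_le_arctan (y := (11 : ℝ) / 23) (by norm_num)
  obtain ⟨a1, a2⟩ := log_325_bounds
  obtain ⟨b1, b2⟩ := log_4_bounds
  have hpi := Real.pi_gt_d6
  rw [hlog, hat]
  norm_num at hL hpi ⊢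
  linarith

/-- `Γ₃(19/2) = 19/2·log(397/4) − 19 + 6·arctan(19/6) ≥ 1290681/40000` (true value `32.2671030`). -/
theorem gam3_tau6_lower :
    (1290681 / 40000 : ℝ) ≤ 19 / 2 * Real.log (397 / 4) - 19 + 6 * Real.arctan (19 / 6) := by
  have hlog : Real.log ((397 : ℝ) / 4) = Real.log 397 - Real.log 4 := Real.log_div (by norm_num) (by norm_num)
  have hat : Real.arctan ((19 / 6 : ℝ)) = π / 4 + Real.arctan (13 / 25) := by
    rw [show ((19 / 6 : ℝ)) = (19 / 2) / 3 by norm_num, arctan_div_three (by norm_num)]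
    norm_num
  have hL := taylor11_le_arctan (y := (13 : ℝ) / 25) (by norm_num)
  obtain ⟨a1, a2⟩ := log_397_bounds
  obtain ⟨b1, b2⟩ := log_4_bounds
  have hpi := Real.pi_gt_d6
  rw [hlog, hat]
  norm_num at hL hpi ⊢
  linarith

/-- **`Ψ ≤ −95.359`** in explicit form: `2Γ₃(41/2) − 2·(Γ₃(7/2) + ⋯ + Γ₃(19/2)) ≤ −95359/1000` (true value `−95.3595`). -/
theorem psi_explicit_le :
    2 * (41 / 2 * Real.log (1717 / 4) - 41 + 6 * Real.arctan (41 / 6))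
      - 2 * ((7 / 2 * Real.log (85 / 4) - 7 + 6 * Real.arctan (7 / 6)) + (9 / 2 * Real.log (117 / 4) - 9 + 6 * Real.arctan (3 / 2)) + (11 / 2 * Real.log (157 / 4) - 11 + 6 * Real.arctan (11 / 6)) + (13 / 2 * Real.log (205 / 4) - 13 + 6 * Real.arctan (13 / 6)) + (15 / 2 * Real.log (261 / 4) - 15 + 6 * Real.arctan (5 / 2)) + (17 / 2 * Real.log (325 / 4) - 17 + 6 * Real.arctan (17 / 6)) + (19 / 2 * Real.log (397 / 4) - 19 + 6 * Real.arctan (19 / 6))) ≤ -(95359 / 1000 : ℝ) := by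
  have h0 := gam3_record_upper
  have h1 := gam3_tau0_lower
  have h2 := gam3_tau1_lower
  have h3 := gam3_tau2_lower
  have h4 := gam3_tau3_lower
  have h5 := gam3_tau4_lower
  have h6 := gam3_tau5_lower
  have h7 := gam3_tau6_lower
  linarith

end Summit.KontsevichZagierPeriods.Zeta5Search.LogEnclosures
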